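import Mathlib.Analysis.Calculus.ContDiff.FTaylorSeries
import Mathlib.Analysis.Complex.Basic
import Mathlib.Analysis.Complex.Exponential
import Mathlib.Analysis.Normed.Group.Submodule
import Mathlib.Analysis.Normed.Module.Basic
import Mathlib.Algebra.MvPolynomial.Degrees
import Mathlib.GroupTheory.QuotientGroup.Defs
import Mathlib.LinearAlgebra.Dimension.Finrank
import Mathlib.Data.Set.Card
import HarnessLib

/-!
# Philippon's zero estimate (lemme de zéros) on `𝔾ₐ × 𝔾ₘ^m`

Topic: `Literature/NumberTheory/Transcendental` (trunk T-TRANSCEND). Fact item `wi-03403`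
(routes `Schanuel/RoyCriterion`, `Schanuel/AlgIndepMethod`): Philippon's multiplicity / zero
estimate on commutative algebraic groups, **stated for the linear group `G = 𝔾ₐ × 𝔾ₘ^m` over `ℂ`**
(the case used by Gel'fond's method, Roy's programme and the Gelfond–Diaz ladder).

## The printed statement (Philippon 1986, Théorème 2.1, p. 358 — verified on the page)

Notation (loc. cit. §2, pp. 357–358): `K = ℂ` (or `ℂ_ℓ`); `G = G₁ × ⋯ × G_p` a product of commutative
algebraic groups over `K` of dimensions `n₁, …, n_p`, `n = n₁ + ⋯ + n_p`, each `G_i` embedded as a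
quasi-projective subvariety of `ℙ_{N_i}`, so `G ⊂ ℙ = ℙ_{N₁} × ⋯ × ℙ_{N_p}` with multihomogeneous
coordinate ring `R`; `Φ : K^d → G(K)` an analytic subgroup (a homomorphism analytic near `0`),
`A = im Φ`; `Σ ⊂ G(K)` finite containing the origin, `Σ(n) = {x₁ + ⋯ + x_n ; x_i ∈ Σ}`;
`ord_g P` (order of vanishing of `P` at `g` along `A`) = order at `z = 0` of the analytic function
`z ↦ P(τ_g ∘ Φ (z))`; `codim_A(A ∩ G') = d - d'`; `H(V; d₁, …, d_p) = (dim V)! ×` (top homogeneous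
part of the multihomogeneous Hilbert–Samuel polynomial of `V`), so that for `p = 1`,
`H(V; d) = deg V · d^{dim V}`. "Avec ces notations nous expliciterons dans les paragraphes 4 et 5
des entiers rationnels `c₁, …, c_p ≥ 1`, où `c_i` ne dépend que du plongement de `G_i` dans
`ℙ_{N_i}`, tels que l'on ait le théorème suivant :

**Théorème 2.1.** Soit `T ∈ ℕ`, on suppose qu'un polynôme `P` de multidegré `(D₁, …, D_p)` de `R`
s'annule à un ordre `≥ nT + 1` le long de `A` en chaque point de `Σ(n)`. Alors il existe un
sous-groupe algébrique connexe `G'` de `G`, incomplètement défini dans `G` par des équations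
multihomogènes de multidegrés `≤ (c₁D₁, …, c_pD_p)`, contenu dans un translaté de `G ∩ 𝒵(P)` et
tel que
`binom(T + codim_A(A ∩ G'), codim_A(A ∩ G')) · card((Σ + G')/G') · H(G'; D₁, …, D_p)
   ≤ H(G; c₁D₁, …, c_pD_p)`."

(The 1987 errata only *strengthen* this: `P` vanishes on all translates `σ + G'`, `σ ∈ Σ`; and
list typos elsewhere. Roy's exposition, Nesterenko–Philippon (eds.) 2001, Ch. 11 Thm 4.1, is the
homogeneous (`p = 1`) version with the same shape, `T` an integer `≥ 0`.)

## What is vendored here (special case, weakened only)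

We take `K = ℂ`, `p = 2`, `G₁ = 𝔾ₐ ⊂ ℙ¹` (`x ↦ (1 : x)`), `G₂ = 𝔾ₘ^m ⊂ ℙ^m`
(`y ↦ (1 : y₁ : ⋯ : y_m)`), so `n = m + 1`, and read the conclusion through the following
elementary evaluations/inequalities (documented, not formalised):

* a nonzero `P ∈ ℂ[X, Y₁, …, Y_m]` with `deg_X P ≤ D₀`, total `Y`-degree `≤ D₁` (`D₀, D₁ ≥ 1`) is
  the dehomogenisation of a nonzero form of multidegree exactly `(D₀, D₁)`; since `G` is dense in
  `ℙ¹ × ℙ^m`, `P ≠ 0` iff `P` does not vanish identically on `G`;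
* the immersive analytic subgroups of `G(ℂ) = ℂ × (ℂˣ)^m` are `A = exp_G(W)`,
  `exp_G(w₀, v) = (w₀, e^{v₁}, …, e^{v_m})`, for `W` a `d`-dimensional subspace of
  `Lie G = ℂ × ℂ^m`, `d ≥ 1`; then `codim_A(A ∩ G') = dim W - dim (W ∩ Lie G')`;
* the connected algebraic subgroups of `𝔾ₐ × 𝔾ₘ^m` are the products `G' = V × T'` with
  `V ∈ {0, 𝔾ₐ}` and `T'` a subtorus, i.e. `T' = ⋂_{χ ∈ M} ker χ` for a *saturated* subgroup
  `M ≤ ℤ^m = X(𝔾ₘ^m)`; `Lie T' = {v ; ∑ χ_j v_j = 0 ∀ χ ∈ M}`, `dim G' = dim Lie G'`;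
* for such `G'` of bidimension `(δ₀, δ₁)`,
  `H(G'; D₀, D₁) = binom(δ₀ + δ₁, δ₀) · deg(closure of T' in ℙ^m) · D₀^{δ₀} D₁^{δ₁} ≥ D₀^{δ₀} D₁^{δ₁}`
  and `H(G; c₁D₀, c₂D₁) = (m + 1) c₁ c₂^m · D₀ D₁^m`.

Hence Théorème 2.1 gives, with `c = (m + 1) c₁ c₂^m` depending only on `m`:
`binom(T + s, s) · card((Σ + G')/G') · D₀^{δ₀} D₁^{δ₁} ≤ c · D₀ D₁^m`, `s = dim W - dim(W ∩ Lie G')`,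
for some connected algebraic subgroup `G'` contained in a translate of the zero set of `P`
(in particular `G' ≠ G`). The clause "incomplètement défini par des équations de multidegrés
`≤ (c₁D₀, c₂D₁)`" and the factor `deg T̄'` are **dropped** (Mathlib has no multiprojective degree);
what remains is a corollary of the printed theorem, never stronger than it.

Nothing is asserted: users take `(h : Philippon1986_GaGm)`.

## Contents

* `GaGm m` — the group of complex points `ℂ × (ℂˣ)^m` of `𝔾ₐ × 𝔾ₘ^m` (multiplicative notation).
* `GaGm.exp` — the exponential map `Lie G = ℂ × ℂ^m → G(ℂ)`.
* `GaGm.coord`, `GaGm.evalAt` — affine coordinates `(x, y₁, …, y_m)` and evaluation of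
  `P ∈ MvPolynomial (Fin (m+1)) ℂ` (index `0` is `X`, index `j.succ` is `Y_j`).
* `GaGm.VanishesToOrder P W g N` — `ord_g P ≥ N` along `exp_G(W)` (all Fréchet derivatives of
  order `< N` of `w ↦ P(g · exp_G w)` on `W` vanish at `0`).
* `GaGm.sumset S n` — Philippon's `Σ(n)`.
* `GaGm.ConnAlgSubgroup m` — connected algebraic subgroups (data: additive part on/off, saturated
  character lattice), with `toSubgroup`, `torusTangent`, `tangent`.
* `Philippon1986_GaGm` — the named fact.

## References

* P. Philippon, *Lemmes de zéros dans les groupes algébriques commutatifs*, Bull. Soc. Math.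
  France 114 (1986), 355–383, Théorème 2.1 (p. 358); Errata et addenda, ibid. 115 (1987), 397–398.
* Yu. V. Nesterenko, P. Philippon (eds.), *Introduction to Algebraic Independence Theory*, LNM 1752
  (2001), Ch. 11 (D. Roy), Theorem 4.1 (homogeneous version).
-/

noncomputable section

open MvPolynomial Complex

namespace Literature.NumberTheory.Transcendental

/-- The complex points `ℂ × (ℂˣ)^m` of the commutative linear algebraic group `𝔾ₐ × 𝔾ₘ^m`, as a
multiplicative commutative group (`Multiplicative ℂ` for the additive factor). [folklore] -/
abbrev GaGm (m : ℕ) : Type := Multiplicative ℂ × (Fin m → ℂˣ)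

namespace GaGm

variable {m : ℕ}

/-- The exponential map of `𝔾ₐ × 𝔾ₘ^m`: `(w₀, v) ↦ (w₀, e^{v₁}, …, e^{v_m})` from the Lie algebra
`ℂ × ℂ^m`; its restrictions to subspaces `W` are the (immersive) analytic subgroups `Φ : W → G(ℂ)`
of Philippon 1986, §2. [folklore] -/
def exp (w : ℂ × (Fin m → ℂ)) : GaGm m :=
  (Multiplicative.ofAdd w.1, fun j => Units.mk0 (Complex.exp (w.2 j)) (Complex.exp_ne_zero _))

/-- `exp_G(0) = e`. [folklore] -/
@[simp] theorem exp_zero : exp (0 : ℂ × (Fin m → ℂ)) = 1 := by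
  ext j <;> simp [exp]

/-- `exp` is a homomorphism from the (additive) Lie algebra to the group. [folklore] -/
theorem exp_add (w w' : ℂ × (Fin m → ℂ)) : exp (w + w') = exp w * exp w' := by
  ext j <;> simp [exp, ofAdd_add, Complex.exp_add]

/-- Affine coordinates of a point: index `0` is the `𝔾ₐ`-coordinate `x`, index `j.succ` is `y_j`.
[folklore] -/
def coord (g : GaGm m) : Fin (m + 1) → ℂ :=
  Fin.cons (Multiplicative.toAdd g.1) (fun j => ((g.2 j : ℂˣ) : ℂ))

/-- The `0`-th coordinate is the additive one. [folklore] -/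
@[simp] theorem coord_zero (g : GaGm m) : coord g 0 = Multiplicative.toAdd g.1 := by
  simp [coord]

/-- The `j.succ`-th coordinate is `y_j`. [folklore] -/
@[simp] theorem coord_succ (g : GaGm m) (j : Fin m) : coord g j.succ = (g.2 j : ℂ) := by
  simp [coord]

/-- Value of the affine polynomial `P ∈ ℂ[X, Y₁, …, Y_m]` at the point `g ∈ G(ℂ)`. [folklore] -/
def evalAt (P : MvPolynomial (Fin (m + 1)) ℂ) (g : GaGm m) : ℂ :=
  MvPolynomial.eval (coord g) P

/-- **Order of vanishing along an analytic subgroup** (Philippon 1986, §2, pp. 357–358): for a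
subspace `W` of the Lie algebra, `P` vanishes to order at least `N` at `g` along `A = exp_G(W)` iff
the analytic function `f : W → ℂ`, `f(w) = P(g · exp_G(w))`, has all its Fréchet derivatives of
order `< N` equal to `0` at `w = 0` (i.e. its Taylor expansion at `0` starts in degree `≥ N`;
`f ≡ 0` gives order `∞ ≥ N`). [cite: Philippon1986, §2] -/
def VanishesToOrder (P : MvPolynomial (Fin (m + 1)) ℂ) (W : Submodule ℂ (ℂ × (Fin m → ℂ)))
    (g : GaGm m) (N : ℕ) : Prop :=
  ∀ k < N, iteratedFDeriv ℂ k (fun w : W => evalAt P (g * exp (w : ℂ × (Fin m → ℂ)))) 0 = 0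

/-- Order `≥ 0` is no condition. [folklore] -/
@[simp] theorem vanishesToOrder_zero (P : MvPolynomial (Fin (m + 1)) ℂ)
    (W : Submodule ℂ (ℂ × (Fin m → ℂ))) (g : GaGm m) : VanishesToOrder P W g 0 :=
  fun _k hk => absurd hk (Nat.not_lt_zero _)

/-- Order `≥ 1` along any analytic subgroup just means `P(g) = 0`. [folklore] -/
theorem vanishesToOrder_one_iff (P : MvPolynomial (Fin (m + 1)) ℂ)
    (W : Submodule ℂ (ℂ × (Fin m → ℂ))) (g : GaGm m) :
    VanishesToOrder P W g 1 ↔ evalAt P g = 0 := by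
  constructor
  · intro h
    have h0 := congrArg (‖·‖) (h 0 Nat.zero_lt_one)
    simp only [norm_iteratedFDeriv_zero, norm_zero, norm_eq_zero] at h0
    simpa using h0
  · intro h k hk
    obtain rfl : k = 0 := Nat.lt_one_iff.mp hk
    rw [← norm_eq_zero, norm_iteratedFDeriv_zero]
    simpa using h

/-- Order `≥ N` implies order `≥ N'` for `N' ≤ N`. [folklore] -/
theorem VanishesToOrder.mono {P : MvPolynomial (Fin (m + 1)) ℂ}
    {W : Submodule ℂ (ℂ × (Fin m → ℂ))} {g : GaGm m} {N N' : ℕ}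
    (h : VanishesToOrder P W g N) (hN : N' ≤ N) : VanishesToOrder P W g N' :=
  fun k hk => h k (lt_of_lt_of_le hk hN)

/-- Philippon's `Σ(n) = {x₁ + ⋯ + x_n ; x_i ∈ Σ}` (here multiplicatively: `n`-fold products of
elements of `S`; `Σ(0) = {e}`). [cite: Philippon1986, §2] -/
def sumset (S : Set (GaGm m)) (n : ℕ) : Set (GaGm m) :=
  {g | ∃ σ : Fin n → GaGm m, (∀ i, σ i ∈ S) ∧ g = ∏ i, σ i}

/-- `Σ(0) = {e}` (Philippon 1986, §2). [folklore] -/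
theorem sumset_zero (S : Set (GaGm m)) : sumset S 0 = {1} := by
  ext g
  simp [sumset]

/-- If `e ∈ S` then `S ⊆ Σ(n)` for `n ≥ 1`. [folklore] -/
theorem subset_sumset {S : Set (GaGm m)} (hS : (1 : GaGm m) ∈ S) {n : ℕ} (hn : 1 ≤ n) :
    S ⊆ sumset S n := by
  intro g hg
  obtain ⟨k, rfl⟩ : ∃ k, n = k + 1 := ⟨n - 1, by omega⟩
  refine ⟨Fin.cons g (fun _ => 1), ?_, ?_⟩
  · refine Fin.cases ?_ (fun i => ?_) <;> simp [hg, hS]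
  · simp [Fin.prod_univ_succ]

/-- **Connected algebraic subgroups of `𝔾ₐ × 𝔾ₘ^m`.** Such a subgroup is `V × T'` with
`V ∈ {0, 𝔾ₐ}` (`addPart = false / true`) and `T' = {y ; y^χ = 1 ∀ χ ∈ M}` the subtorus cut out by
a subgroup `M ≤ ℤ^m` of characters; `T'` is connected iff `M` is saturated
(`kχ ∈ M, k ≠ 0 ⇒ χ ∈ M`). [folklore] -/
structure ConnAlgSubgroup (m : ℕ) where
  /-- `true`: the unipotent part is all of `𝔾ₐ`; `false`: it is trivial. -/
  addPart : Bool
  /-- The characters `χ ∈ ℤ^m` of `𝔾ₘ^m` that are trivial on the torus part. -/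
  chars : AddSubgroup (Fin m → ℤ)
  /-- Saturation of the character lattice (= connectedness of the subtorus). -/
  saturated : ∀ (k : ℤ) (χ : Fin m → ℤ), k ≠ 0 → k • χ ∈ chars → χ ∈ chars

namespace ConnAlgSubgroup

/-- The group of complex points of `G' = V × T'`. [folklore] -/
def toSubgroup (H : ConnAlgSubgroup m) : Subgroup (GaGm m) where
  carrier := {g | (H.addPart = false → g.1 = 1) ∧ ∀ χ ∈ H.chars, ∏ j, (g.2 j) ^ (χ j) = 1}
  one_mem' := by simp
  mul_mem' := by
    rintro ⟨a, y⟩ ⟨a', y'⟩ ⟨ha, hy⟩ ⟨ha', hy'⟩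
    refine ⟨fun h => ?_, fun χ hχ => ?_⟩
    · have h1 : a = 1 := ha h
      have h2 : a' = 1 := ha' h
      simp [h1, h2]
    · have e : ∏ j, ((y * y') j) ^ (χ j) = (∏ j, (y j) ^ (χ j)) * ∏ j, (y' j) ^ (χ j) := by
        simp [mul_zpow, Finset.prod_mul_distrib]
      have h1 : ∏ j, (y j) ^ (χ j) = 1 := hy χ hχ
      have h2 : ∏ j, (y' j) ^ (χ j) = 1 := hy' χ hχ
      show ∏ j, ((y * y') j) ^ (χ j) = 1
      rw [e, h1, h2, one_mul]
  inv_mem' := by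
    rintro ⟨a, y⟩ ⟨ha, hy⟩
    refine ⟨fun h => ?_, fun χ hχ => ?_⟩
    · have h1 : a = 1 := ha h
      simp [h1]
    · have e : ∏ j, ((y⁻¹) j) ^ (χ j) = (∏ j, (y j) ^ (χ j))⁻¹ := by
        simp [Finset.prod_inv_distrib]
      have h1 : ∏ j, (y j) ^ (χ j) = 1 := hy χ hχ
      show ∏ j, ((y⁻¹) j) ^ (χ j) = 1
      rw [e, h1, inv_one]

/-- The Lie algebra of the torus part: `{v ∈ ℂ^m ; ∑ⱼ χⱼ vⱼ = 0 for all χ ∈ M}`. [folklore] -/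
def torusTangent (H : ConnAlgSubgroup m) : Submodule ℂ (Fin m → ℂ) where
  carrier := {v | ∀ χ ∈ H.chars, ∑ j, (χ j : ℂ) * v j = 0}
  zero_mem' := by simp
  add_mem' := by
    intro v v' hv hv' χ hχ
    simp only [Pi.add_apply, mul_add, Finset.sum_add_distrib, hv χ hχ, hv' χ hχ, add_zero]
  smul_mem' := by
    intro c v hv χ hχ
    simp only [Pi.smul_apply, smul_eq_mul, mul_left_comm _ c, ← Finset.mul_sum, hv χ hχ,
      mul_zero]

/-- The Lie algebra `Lie G' ≤ Lie G = ℂ × ℂ^m` of `G' = V × T'`. [folklore] -/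
def tangent (H : ConnAlgSubgroup m) : Submodule ℂ (ℂ × (Fin m → ℂ)) :=
  (if H.addPart then ⊤ else ⊥ : Submodule ℂ ℂ).prod H.torusTangent

/-- Dimension `δ₀ ∈ {0, 1}` of the additive part. [folklore] -/
def addDim (H : ConnAlgSubgroup m) : ℕ := if H.addPart then 1 else 0

/-- Dimension `δ₁` of the torus part (`= dim Lie T'`). [folklore] -/
def torusDim (H : ConnAlgSubgroup m) : ℕ := Module.finrank ℂ H.torusTangent

/-- The whole group `G` (`V = 𝔾ₐ`, `M = 0`). [folklore] -/
def top (m : ℕ) : ConnAlgSubgroup m where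
  addPart := true
  chars := ⊥
  saturated := by
    intro k χ hk h
    rw [AddSubgroup.mem_bot] at h ⊢
    exact (smul_eq_zero.mp h).resolve_left hk

/-- The trivial subgroup `{e}` (`V = 0`, `M = ℤ^m`). [folklore] -/
def bot (m : ℕ) : ConnAlgSubgroup m where
  addPart := false
  chars := ⊤
  saturated := fun _ _ _ _ => AddSubgroup.mem_top _

/-- Every point lies in `top`. [folklore] -/
@[simp] theorem mem_toSubgroup_top (g : GaGm m) : g ∈ (top m).toSubgroup := by
  simp [top, toSubgroup]

/-- `bot` is the trivial subgroup. [folklore] -/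
theorem mem_toSubgroup_bot_iff (g : GaGm m) : g ∈ (bot m).toSubgroup ↔ g = 1 := by
  constructor
  · rintro ⟨h1, h2⟩
    ext j
    · simpa using h1 rfl
    · have := h2 (Pi.single j 1) (AddSubgroup.mem_top _)
      rw [Finset.prod_eq_single j (fun b _ hb => by simp [Pi.single_eq_of_ne hb])
        (fun h => absurd (Finset.mem_univ j) h)] at this
      simpa using this
  · rintro rfl
    simp [bot, toSubgroup]

end ConnAlgSubgroup

end GaGm

open GaGm in
/-- **Philippon's zero estimate on `𝔾ₐ × 𝔾ₘ^m`** (Philippon 1986, Théorème 2.1, special case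
`K = ℂ`, `G = 𝔾ₐ × 𝔾ₘ^m ⊂ ℙ¹ × ℙ^m`, `n = m + 1`; see the module docstring for the printed statement
and the elementary reductions). For every `m` there is a constant `c` (namely
`(m+1) c₁ c₂^m` with Philippon's embedding constants `c₁, c₂`) such that: for integers
`D₀, D₁ ≥ 1`, `T ≥ 0`, a subspace `W ≠ 0` of `Lie G = ℂ × ℂ^m` (analytic subgroup `A = exp_G(W)`),
a finite `Σ ⊂ G(ℂ)` containing `e`, and a nonzero `P ∈ ℂ[X, Y₁, …, Y_m]` with `deg_X P ≤ D₀` and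
total `Y`-degree `≤ D₁` vanishing to order `≥ (m+1)T + 1` along `A` at every point of `Σ(m+1)`,
there is a connected algebraic subgroup `G' = V × T'` of `G`, contained in a translate of the zero
set of `P` (hence `G' ≠ G`), with
`binom(T + s, s) · card((Σ·G')/G') · D₀^{δ₀} · D₁^{δ₁} ≤ c · D₀ · D₁^m`,
where `s = dim W - dim (W ∩ Lie G')`, `δ₀ = dim V`, `δ₁ = dim T'`. This is the printed inequality
`binom(T + codim_A(A∩G'), codim_A(A∩G')) · card((Σ+G')/G') · H(G'; D₀, D₁) ≤ H(G; c₁D₀, c₂D₁)`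
read through `H(G'; D₀, D₁) ≥ D₀^{δ₀} D₁^{δ₁}` and `H(G; c₁D₀, c₂D₁) = (m+1)c₁c₂^m D₀D₁^m`.
[cite: Philippon1986, Thm 2.1] -/
def Philippon1986_GaGm : Prop :=
  ∀ m : ℕ, ∃ c : ℕ, ∀ (D₀ D₁ T : ℕ) (W : Submodule ℂ (ℂ × (Fin m → ℂ))) (S : Set (GaGm m))
    (P : MvPolynomial (Fin (m + 1)) ℂ),
    1 ≤ D₀ → 1 ≤ D₁ → 0 < Module.finrank ℂ W → S.Finite → (1 : GaGm m) ∈ S → P ≠ 0 →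
    P.degreeOf 0 ≤ D₀ → (∀ s ∈ P.support, ∑ j : Fin m, s (Fin.succ j) ≤ D₁) →
    (∀ g ∈ sumset S (m + 1), VanishesToOrder P W g ((m + 1) * T + 1)) →
    ∃ H : ConnAlgSubgroup m,
      (∃ g : GaGm m, ∀ h ∈ H.toSubgroup, evalAt P (g * h) = 0) ∧
      Nat.choose (T + (Module.finrank ℂ W - Module.finrank ℂ ↥(W ⊓ H.tangent)))
          (Module.finrank ℂ W - Module.finrank ℂ ↥(W ⊓ H.tangent)) *
        Set.ncard ((QuotientGroup.mk : GaGm m → GaGm m ⧸ H.toSubgroup) '' S) *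
        D₀ ^ H.addDim * D₁ ^ H.torusDim ≤ c * D₀ * D₁ ^ m

end Literature.NumberTheory.Transcendental
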